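import Summits.QuantumFields.YangMills.Theorems.UnitScaleTiltProp7SectET3Transport
import Literature.MathematicalPhysics.QuantumFieldTheory.Balaban1983to89.B9Eq315QTower
import Literature.MathematicalPhysics.QuantumFieldTheory.Balaban1983to89.T3LevelShift
import HarnessLib

/-!
# Route `UnitScaleTilt`, crux K1 child «MinimiserStabilityRegPr» (stmt-QuantumFields-19200), stub `stub_existenceMinimalOrbit` (EX), route (α) —
# THE CHART OF RECORD ONTO THE LATTICE OF RECORD: `siteEquivTower F n K : Site (F.P K) 0 ≃ TSite 3 (towerP F.L m (K−n))`, `m _ := 2L^{F.m+n}`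
# (★w5-20520's `Prop7SectET3Transport.siteEquiv F K` composed with ONE `Fin.cast` equivalence `towerCast`), shift-compatible, and the [B11] background
# `bgOfCfgTower` of an `SU(2)` configuration read there

Cell `ym3-torus`, width seat `ym-ust-20520-w4` (gen 2; OWNER ym3-torus-plan g25 RULING (J) 2026-08-28T02:14:16Z «THE LATTICE OF RECORD for every (115)-letter object
under EX (the pair (H̃_{1,k}, C_k), `W80`, and hence the `SectEDatum` instance (S2)) = `towerP F.L m (K−n)` with `m _ := 2L^{F.m+n}` … the route's objects reach it by
★w5's `siteEquiv F K` composed with ONE `Fin.cast`-type equivalence `towerCast F n K`»; re-assigned to this seat 02:32:16Z).  YM₃ on T³ is a ladder rung (R3), NOT the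
Clay problem; nothing here is a claim about the stub, the crux, d = 4 or the mass gap.  `--supports stmt-QuantumFields-19200 --as helper`; count-neutral.

THE OBJECTS.  A member `(F, n, K)` of the route (`T3ContinuumYM3Torus.T3Family`, `n ≤ K`) has finest lattice `Site (F.P K) 0 = Fin 3 → ZMod (2L^{F.m+K})`
(`T3Family.sitesPerDir_PP`); the [B9]∕[B11] tower objects of the NE9 lineage (`B9Eq315QTower.towerP L m k`: `towerP L m k i = L^k·m i`, `towerP_apply`;
`B11Eq103H1Complex.H1LatticeCLM`, `B11Eq44CLetterTower.Cck`, `B9Eq326OperatorTower.QkW`, …) live on `TSite 3 (towerP L m k) = Π_i Fin (L^k·m i)`.  With the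
COARSE PERIODS OF RECORD `towerPeriodsT3 F n := fun _ ↦ 2L^{F.m+n}` and HEIGHT `K − n`, `towerP F.L (towerPeriodsT3 F n) (K−n) i = L^{K−n}·2L^{F.m+n} = 2L^{F.m+K}
= periodsT3 F K i` (`towerP_towerPeriodsT3`, propositional), so the two site types are related by the coordinatewise `Fin.cast` — an equivalence preserving the
coordinate VALUES, hence the unit steps.

WHAT IS DEFINED AND PROVED (sorry-free; three small definitions `towerCast`, `siteEquivTower`, `bgOfCfgTower`; everything else [folklore] bookkeeping by `rfl`∕`Fin.ext`).
* §1 `towerPeriodsT3` (abbrev), `towerPeriodsT3_apply`, `towerPeriodsT3_pos`, `one_le_towerPeriodsT3` (the `_hm : ∀ i, 1 ≤ m i` binder of the tower theorems),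
  `towerPeriodsT3_neZero` (the `[∀ i, NeZero (m i)]` binder, as a theorem — supply with `haveI`), **`towerP_towerPeriodsT3`** (`n ≤ K`), `eta_tower_mul_pow`
  (`((L:ℝ)⁻¹)^{K−n}·L^{(K−n−1)+1} = 1` for `n < K` — the `_hηL` binder at height `(K−n−1)+1`).
* §2 **`towerCast F n K hnK : TSite 3 (periodsT3 F K) ≃ TSite 3 (towerP F.L (towerPeriodsT3 F n) (K − n))`** (coordinatewise `Fin.cast`), `towerCast_apply_val`,
  `towerCast_symm_apply_val`, **`towerCast_shift`** (`towerCast (y + e_μ) = towerCast y + e_μ` for `B9SectCLatticeCarrier.shift`), `towerCast_symm_shift`.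
* §3 **`siteEquivTower F n K hnK := (siteEquiv F K).trans (towerCast F n K hnK) : Site (F.P K) 0 ≃ TSite 3 (towerP F.L (towerPeriodsT3 F n) (K − n))`** — THE CHART
  OF RECORD ONTO THE LATTICE OF RECORD; `siteEquivTower_apply`, **`siteEquivTower_shift`**, **`siteEquivTower_shiftEquiv`** (the `he` hypothesis of ★w2-19200 g2's
  `Prop7SectET3ObjectsPd` rows at `e := siteEquivTower F n K hnK`, discharged), `siteEquivTower_symm_shift`.
* §4 **`bgOfCfgTower F n K hnK U₀ : Bond 3 (towerP F.L (towerPeriodsT3 F n) (K − n)) → (M₂(ℂ))ˣ`** := `cfgEquivOf (siteEquivTower …) _ (unitsField (toUField U₀))`;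
  **`bgOfCfgTower_eq`** (`= fun b ↦ unitsField (toUField U₀) ⟨(siteEquivTower …)⁻¹ b.1, b.2⟩`, `rfl` — the lambda ★w2-19200 g2's abstract-`e` rows produce),
  `val_bgOfCfgTower`, **`isUnitaryBg_bgOfCfgTower`**.
* §5 THE SAME AT AN ARBITRARY HEIGHT LETTER `k` WITH `n + k = K` (appended): the tower theorems of the NE9 lineage are indexed by a SUCCESSOR height
  (`towerP L m (j+1)`, `H1LatticeCLM`, `Cck`, `QkW`, …), and `towerP F.L m (K − n)` does not unify with `towerP F.L m (?j + 1)`; so the chart is re-issued with the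
  height a free letter: **`towerCastAt F n K k hk : TSite 3 (periodsT3 F K) ≃ TSite 3 (towerP F.L (towerPeriodsT3 F n) k)`** (`hk : n + k = K`), `towerCastAt_shift`,
  **`siteEquivTowerAt F n K k hk := (siteEquiv F K).trans (towerCastAt …)`**, `siteEquivTowerAt_shift`, **`siteEquivTowerAt_shiftEquiv`**, `siteEquivTowerAt_symm_shift`,
  **`bgOfCfgTowerAt`**, `bgOfCfgTowerAt_eq` (rfl), `val_bgOfCfgTowerAt`, `isUnitaryBg_bgOfCfgTowerAt` — consumers take `k := j + 1` (`hk : n + (j + 1) = K`) and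
  meet `towerP F.L (towerPeriodsT3 F n) (j + 1)` ON THE NOSE; `eta_tower_mul_pow_of_add` (`((L:ℝ)⁻¹)^(j+1)·L^(j+1) = 1`).
HONEST SCOPE.  Re-indexing only; no analytic content; the (115)-letter objects themselves are not instantiated here (that is (S2), ★w2-19200 g2).

References: T. Bałaban, CMP 102 (1985) 255–275 [Balaban1985UV3] ((1)–(3) p.256: the lattices `T_η`, `η = L^{−k}ε`); CMP 98 (1985) 17–51
[Balaban1985Averaging] ((1) p.17 (the sequence of lattices `L^{−j}`), (19) p.21); CMP 102 (1985) 277–309 [Balaban1985Variational] (p.277 «G ⊂ U(N)»).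
-/

noncomputable section

open scoped Matrix.Norms.L2Operator

namespace Summit.QuantumFields.YangMills.Theorems.Prop7SectET3TransportTower

open Literature.MathematicalPhysics.QuantumFieldTheory.Balaban1983to89
open Literature.MathematicalPhysics.QuantumFieldTheory.Balaban1983to89.T3ContinuumYM3Torus
open Literature.MathematicalPhysics.QuantumFieldTheory.Balaban1983to89.B10Eq27TorusAxialLog (toUField unitsField val_unitsField)
open B9SectCLatticeCarrier (Bond shift)
open B4Sect5Torus (TSite)
open B9Eq315QTower (towerP towerP_apply)
open Summit.QuantumFields.YangMills.Theorems.Prop7SectET3Transport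

variable (F : T3Family) (n K : ℕ)

/-! ## §1 The coarse periods of record and the period identity -/

/-- **THE COARSE PERIODS OF RECORD** `m _ := 2L^{F.m+n}` (the level-`n` lattice of the member has `2L^{F.m+n}` sites per direction; the tower of height `K − n` above it
ends at the finest lattice `2L^{F.m+K}`). [cite: Balaban1985UV3, (1)-(3) p.256] -/
abbrev towerPeriodsT3 : Fin 3 → ℕ := fun _ => 2 * F.L ^ (F.m + n)

/-- Unfolding the coarse periods. [cite: Balaban1985UV3, (1)-(3) p.256] -/
theorem towerPeriodsT3_apply (i : Fin 3) : towerPeriodsT3 F n i = 2 * F.L ^ (F.m + n) := rfl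

/-- The coarse periods are positive (`L ≥ 3`). [folklore] -/
theorem towerPeriodsT3_pos (i : Fin 3) : 0 < towerPeriodsT3 F n i := by
  have hL : 0 < F.L := by have := F.hL.2; omega
  rw [towerPeriodsT3_apply]; positivity

/-- `1 ≤ m i` — the `_hm` binder of the tower theorems (`B11Ineq98W80LatticeFree`, `Prop7SectET3Prop4`). [folklore] -/
theorem one_le_towerPeriodsT3 (i : Fin 3) : 1 ≤ towerPeriodsT3 F n i := towerPeriodsT3_pos F n i

/-- `NeZero (m i)` — the instance binder of the tower theorems, as a theorem (use `haveI := fun i => towerPeriodsT3_neZero F n i`). [folklore] -/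
theorem towerPeriodsT3_neZero (i : Fin 3) : NeZero (towerPeriodsT3 F n i) := ⟨(towerPeriodsT3_pos F n i).ne'⟩

/-- **THE PERIOD IDENTITY**: `towerP F.L (towerPeriodsT3 F n) (K − n) i = L^{K−n}·2L^{F.m+n} = 2L^{F.m+K} = periodsT3 F K i` for `n ≤ K`
(`towerP_apply`, `T3Family.sitesPerDir_PP`). [cite: Balaban1985UV3, (1)-(3) p.256] -/
theorem towerP_towerPeriodsT3 (hnK : n ≤ K) (i : Fin 3) : towerP F.L (towerPeriodsT3 F n) (K - n) i = periodsT3 F K i := by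
  rw [towerP_apply, towerPeriodsT3_apply, periodsT3_apply, T3Family.P_eq_PP, T3Family.sitesPerDir_PP, Nat.sub_zero,
    show F.m + K = (F.m + n) + (K - n) by omega, pow_add]
  ring

/-- **THE SPACING BINDER AT HEIGHT `K − n`**: with `η := L^{−(K−n)}` and `K − n = (K − n − 1) + 1` levels (`n < K`), `η·L^{(K−n−1)+1} = 1` — the `_hηL` binder of the
tower theorems. [cite: Balaban1985UV3, (1)-(3) p.256] -/
theorem eta_tower_mul_pow (hnK : n < K) : ((F.L : ℝ)⁻¹) ^ (K - n) * (F.L : ℝ) ^ (K - n - 1 + 1) = 1 := by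
  have hL : (F.L : ℝ) ≠ 0 := by have := F.hL.2; positivity
  rw [show K - n - 1 + 1 = K - n by omega, inv_pow, inv_mul_cancel₀ (pow_ne_zero _ hL)]

/-! ## §2 The `Fin.cast` equivalence `towerCast` -/

/-- **`towerCast`**: the coordinatewise `Fin.cast` along the period identity — `TSite 3 (periodsT3 F K) ≃ TSite 3 (towerP F.L (towerPeriodsT3 F n) (K − n))`, values
preserved. [folklore] -/
def towerCast (hnK : n ≤ K) : TSite 3 (periodsT3 F K) ≃ TSite 3 (towerP F.L (towerPeriodsT3 F n) (K - n)) where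
  toFun y i := Fin.cast (towerP_towerPeriodsT3 F n K hnK i).symm (y i)
  invFun z i := Fin.cast (towerP_towerPeriodsT3 F n K hnK i) (z i)
  left_inv _ := funext fun _ => Fin.ext rfl
  right_inv _ := funext fun _ => Fin.ext rfl

variable {F n K}

/-- `towerCast` preserves every coordinate value. [folklore] -/
theorem towerCast_apply_val (hnK : n ≤ K) (y : TSite 3 (periodsT3 F K)) (i : Fin 3) : ((towerCast F n K hnK y) i).val = (y i).val := rfl

/-- `towerCast⁻¹` preserves every coordinate value. [folklore] -/
theorem towerCast_symm_apply_val (hnK : n ≤ K) (z : TSite 3 (towerP F.L (towerPeriodsT3 F n) (K - n))) (i : Fin 3) :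
    (((towerCast F n K hnK).symm z) i).val = (z i).val := rfl

/-- **SHIFT-COMPATIBILITY OF `towerCast`**: `towerCast (y + e_μ) = towerCast y + e_μ` (both unit steps are `+1` modulo the SAME period). [folklore] -/
theorem towerCast_shift (hnK : n ≤ K) (y : TSite 3 (periodsT3 F K)) (μ : Fin 3) :
    towerCast F n K hnK (shift μ y) = shift μ (towerCast F n K hnK y) := by
  funext i
  apply Fin.ext
  by_cases h : i = μ
  · subst h
    rw [towerCast_apply_val, B9SectCLatticeCarrier.shift_apply_val, B9SectCLatticeCarrier.shift_apply_val, towerCast_apply_val,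
      towerP_towerPeriodsT3 F n K hnK]
  · rw [towerCast_apply_val, B9SectCLatticeCarrier.shift_apply_ne h, B9SectCLatticeCarrier.shift_apply_ne h, towerCast_apply_val]

/-- … and of its inverse: `towerCast⁻¹ (z + e_μ) = towerCast⁻¹ z + e_μ`. [folklore] -/
theorem towerCast_symm_shift (hnK : n ≤ K) (z : TSite 3 (towerP F.L (towerPeriodsT3 F n) (K - n))) (μ : Fin 3) :
    (towerCast F n K hnK).symm (shift μ z) = shift μ ((towerCast F n K hnK).symm z) := by
  apply (towerCast F n K hnK).injective
  rw [Equiv.apply_symm_apply, towerCast_shift, Equiv.apply_symm_apply]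

/-! ## §3 The chart of record onto the lattice of record -/

variable (F n K) in
/-- **`siteEquivTower := (siteEquiv F K).trans towerCast`** — the route's finest lattice `Site (F.P K) 0` IS the top of the [B9] tower of height `K − n` over the coarse
periods `2L^{F.m+n}`; every (115)-letter object under EX is read through this chart (OWNER RULING (J)). [cite: Balaban1985UV3, (1)-(3) p.256] -/
def siteEquivTower (hnK : n ≤ K) : Site (F.P K) 0 ≃ TSite 3 (towerP F.L (towerPeriodsT3 F n) (K - n)) :=
  (siteEquiv F K).trans (towerCast F n K hnK)

/-- Unfolding the composite chart. [folklore] -/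
theorem siteEquivTower_apply (hnK : n ≤ K) (x : Site (F.P K) 0) : siteEquivTower F n K hnK x = towerCast F n K hnK (siteEquiv F K x) := rfl

/-- Unfolding the inverse composite chart. [folklore] -/
theorem siteEquivTower_symm_apply (hnK : n ≤ K) (z : TSite 3 (towerP F.L (towerPeriodsT3 F n) (K - n))) :
    (siteEquivTower F n K hnK).symm z = (siteEquiv F K).symm ((towerCast F n K hnK).symm z) := rfl

/-- The composite chart reads coordinate `i` as the `ZMod → Fin` value of `x i`. [folklore] -/
theorem siteEquivTower_apply_val (hnK : n ≤ K) (x : Site (F.P K) 0) (i : Fin 3) :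
    ((siteEquivTower F n K hnK x) i).val = ((ZMod.finEquiv ((F.P K).sitesPerDir 0)).symm (x i)).val := rfl

/-- **SHIFT-COMPATIBILITY OF THE CHART OF RECORD**: `e (x + e_μ) = (e x) + e_μ`. [folklore] -/
theorem siteEquivTower_shift (hnK : n ≤ K) (x : Site (F.P K) 0) (μ : Fin 3) :
    siteEquivTower F n K hnK (x.shift μ) = shift μ (siteEquivTower F n K hnK x) := by
  rw [siteEquivTower_apply, siteEquivTower_apply, siteEquiv_shift, towerCast_shift]

/-- … against the bundled step `B9Eq33CovDerivVector.shiftEquiv μ` — EXACTLY the hypothesis `he` of `Prop7SectET3ObjectsPd` ∕ `Prop7SectET3Objects` at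
`e := siteEquivTower F n K hnK`. [folklore] -/
theorem siteEquivTower_shiftEquiv (hnK : n ≤ K) (x : Site (F.P K) 0) (μ : Fin 3) :
    siteEquivTower F n K hnK (x.shift μ) = B9Eq33CovDerivVector.shiftEquiv μ (siteEquivTower F n K hnK x) :=
  siteEquivTower_shift hnK x μ

/-- … and the inverse chart: `e⁻¹ (z + e_μ) = (e⁻¹ z) + e_μ`. [folklore] -/
theorem siteEquivTower_symm_shift (hnK : n ≤ K) (z : TSite 3 (towerP F.L (towerPeriodsT3 F n) (K - n))) (μ : Fin 3) :
    (siteEquivTower F n K hnK).symm (shift μ z) = ((siteEquivTower F n K hnK).symm z).shift μ := by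
  apply (siteEquivTower F n K hnK).injective
  rw [Equiv.apply_symm_apply, siteEquivTower_shift, Equiv.apply_symm_apply]

/-! ## §4 The [B11] background of an `SU(2)` configuration at the lattice of record -/

variable (F n K) in
/-- **THE [B11] BACKGROUND OF AN `SU(2)` CONFIGURATION OF RUN `K` AT THE LATTICE OF RECORD**: `SU(2) ≤ U(2) → (M₂(ℂ))ˣ` re-indexed along `siteEquivTower` —
the `bg` field of the T³ `SectEDatum` instance on `towerP F.L (towerPeriodsT3 F n) (K − n)`. [cite: Balaban1985Averaging, (19) p.21] -/
def bgOfCfgTower (hnK : n ≤ K) (U : GaugeField (F.P K) 0 (Matrix.specialUnitaryGroup (Fin 2) ℂ)) :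
    Bond 3 (towerP F.L (towerPeriodsT3 F n) (K - n)) → (Matrix (Fin 2) (Fin 2) ℂ)ˣ :=
  cfgEquivOf (siteEquivTower F n K hnK) _ (unitsField (toUField U))

/-- **THE BACKGROUND AS A LAMBDA** (the form `Prop7SectET3ObjectsPd`'s rows produce at `e := siteEquivTower F n K hnK`):
`bgOfCfgTower F n K hnK U₀ = fun b ↦ unitsField (toUField U₀) ⟨e⁻¹ b.1, b.2⟩`. [cite: Balaban1985Averaging, (19) p.21] -/
theorem bgOfCfgTower_eq (hnK : n ≤ K) (U : GaugeField (F.P K) 0 (Matrix.specialUnitaryGroup (Fin 2) ℂ)) :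
    bgOfCfgTower F n K hnK U = fun b => unitsField (toUField U) ⟨(siteEquivTower F n K hnK).symm b.1, b.2⟩ := rfl

/-- The background's bond matrix is the configuration's matrix at the pulled-back bond. [cite: Balaban1985Averaging, (19) p.21] -/
theorem val_bgOfCfgTower (hnK : n ≤ K) (U : GaugeField (F.P K) 0 (Matrix.specialUnitaryGroup (Fin 2) ℂ))
    (p : Bond 3 (towerP F.L (towerPeriodsT3 F n) (K - n))) :
    ((bgOfCfgTower F n K hnK U p : (Matrix (Fin 2) (Fin 2) ℂ)ˣ) : Matrix (Fin 2) (Fin 2) ℂ) =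
      ((U ((bondEquivOf (siteEquivTower F n K hnK)).symm p) : Matrix.specialUnitaryGroup (Fin 2) ℂ) : Matrix (Fin 2) (Fin 2) ℂ) := rfl

/-- **THE BACKGROUND IS `G`-VALUED**: `B11Prop6Concrete.IsUnitaryBg (bgOfCfgTower F n K hnK U₀)` (`U₀(b)⁻¹ = U₀(b)^*`). [cite: Balaban1985Variational, p.277] -/
theorem isUnitaryBg_bgOfCfgTower (hnK : n ≤ K) (U : GaugeField (F.P K) 0 (Matrix.specialUnitaryGroup (Fin 2) ℂ)) :
    B11Prop6Concrete.IsUnitaryBg (bgOfCfgTower F n K hnK U) :=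
  isUnitaryBg_unitsField_toUField_comp U (bondEquivOf (siteEquivTower F n K hnK)).symm

/-! ## §5 The chart at an arbitrary height letter `k` with `n + k = K` (take `k := j + 1` to meet the successor-indexed tower theorems) -/

variable (F n K) in
/-- **THE PERIOD IDENTITY AT HEIGHT `k`**: `towerP F.L (towerPeriodsT3 F n) k i = L^k·2L^{F.m+n} = 2L^{F.m+K} = periodsT3 F K i` whenever `n + k = K`.
[cite: Balaban1985UV3, (1)-(3) p.256] -/
theorem towerP_towerPeriodsT3_of_add (k : ℕ) (hk : n + k = K) (i : Fin 3) : towerP F.L (towerPeriodsT3 F n) k i = periodsT3 F K i := by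
  rw [towerP_apply, towerPeriodsT3_apply, periodsT3_apply, T3Family.P_eq_PP, T3Family.sitesPerDir_PP, Nat.sub_zero, ← hk,
    show F.m + (n + k) = (F.m + n) + k by omega, pow_add]
  ring

variable (F) in
/-- **THE SPACING BINDER AT A SUCCESSOR HEIGHT**: `((L:ℝ)⁻¹)^{j+1}·L^{j+1} = 1` — the `_hηL` binder of the tower theorems at `η := L^{−(j+1)}`.
[cite: Balaban1985UV3, (1)-(3) p.256] -/
theorem eta_tower_mul_pow_of_add (j : ℕ) : ((F.L : ℝ)⁻¹) ^ (j + 1) * (F.L : ℝ) ^ (j + 1) = 1 := by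
  have hL : (F.L : ℝ) ≠ 0 := by have := F.hL.2; positivity
  rw [inv_pow, inv_mul_cancel₀ (pow_ne_zero _ hL)]

variable (F n K) in
/-- **`towerCastAt`**: the coordinatewise `Fin.cast` along the period identity at height `k`, `n + k = K`. [folklore] -/
def towerCastAt (k : ℕ) (hk : n + k = K) : TSite 3 (periodsT3 F K) ≃ TSite 3 (towerP F.L (towerPeriodsT3 F n) k) where
  toFun y i := Fin.cast (towerP_towerPeriodsT3_of_add F n K k hk i).symm (y i)
  invFun z i := Fin.cast (towerP_towerPeriodsT3_of_add F n K k hk i) (z i)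
  left_inv _ := funext fun _ => Fin.ext rfl
  right_inv _ := funext fun _ => Fin.ext rfl

/-- `towerCastAt` preserves every coordinate value. [folklore] -/
theorem towerCastAt_apply_val {k : ℕ} (hk : n + k = K) (y : TSite 3 (periodsT3 F K)) (i : Fin 3) : ((towerCastAt F n K k hk y) i).val = (y i).val := rfl

/-- `towerCastAt⁻¹` preserves every coordinate value. [folklore] -/
theorem towerCastAt_symm_apply_val {k : ℕ} (hk : n + k = K) (z : TSite 3 (towerP F.L (towerPeriodsT3 F n) k)) (i : Fin 3) :
    (((towerCastAt F n K k hk).symm z) i).val = (z i).val := rfl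

/-- **SHIFT-COMPATIBILITY OF `towerCastAt`**. [folklore] -/
theorem towerCastAt_shift {k : ℕ} (hk : n + k = K) (y : TSite 3 (periodsT3 F K)) (μ : Fin 3) :
    towerCastAt F n K k hk (shift μ y) = shift μ (towerCastAt F n K k hk y) := by
  funext i
  apply Fin.ext
  by_cases h : i = μ
  · subst h
    rw [towerCastAt_apply_val, B9SectCLatticeCarrier.shift_apply_val, B9SectCLatticeCarrier.shift_apply_val, towerCastAt_apply_val,
      towerP_towerPeriodsT3_of_add F n K k hk]
  · rw [towerCastAt_apply_val, B9SectCLatticeCarrier.shift_apply_ne h, B9SectCLatticeCarrier.shift_apply_ne h, towerCastAt_apply_val]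

/-- … and of its inverse. [folklore] -/
theorem towerCastAt_symm_shift {k : ℕ} (hk : n + k = K) (z : TSite 3 (towerP F.L (towerPeriodsT3 F n) k)) (μ : Fin 3) :
    (towerCastAt F n K k hk).symm (shift μ z) = shift μ ((towerCastAt F n K k hk).symm z) := by
  apply (towerCastAt F n K k hk).injective
  rw [Equiv.apply_symm_apply, towerCastAt_shift, Equiv.apply_symm_apply]

variable (F n K) in
/-- **`siteEquivTowerAt := (siteEquiv F K).trans (towerCastAt …)`** — the chart of record onto the tower lattice of height `k`, `n + k = K` (take `k := j + 1`).
[cite: Balaban1985UV3, (1)-(3) p.256] -/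
def siteEquivTowerAt (k : ℕ) (hk : n + k = K) : Site (F.P K) 0 ≃ TSite 3 (towerP F.L (towerPeriodsT3 F n) k) :=
  (siteEquiv F K).trans (towerCastAt F n K k hk)

/-- Unfolding the composite chart. [folklore] -/
theorem siteEquivTowerAt_apply {k : ℕ} (hk : n + k = K) (x : Site (F.P K) 0) :
    siteEquivTowerAt F n K k hk x = towerCastAt F n K k hk (siteEquiv F K x) := rfl

/-- Unfolding the inverse composite chart. [folklore] -/
theorem siteEquivTowerAt_symm_apply {k : ℕ} (hk : n + k = K) (z : TSite 3 (towerP F.L (towerPeriodsT3 F n) k)) :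
    (siteEquivTowerAt F n K k hk).symm z = (siteEquiv F K).symm ((towerCastAt F n K k hk).symm z) := rfl

/-- **SHIFT-COMPATIBILITY**: `e (x + e_μ) = (e x) + e_μ`. [folklore] -/
theorem siteEquivTowerAt_shift {k : ℕ} (hk : n + k = K) (x : Site (F.P K) 0) (μ : Fin 3) :
    siteEquivTowerAt F n K k hk (x.shift μ) = shift μ (siteEquivTowerAt F n K k hk x) := by
  rw [siteEquivTowerAt_apply, siteEquivTowerAt_apply, siteEquiv_shift, towerCastAt_shift]

/-- … against `B9Eq33CovDerivVector.shiftEquiv μ` — the `he` hypothesis of `Prop7SectET3ObjectsPd` at `e := siteEquivTowerAt F n K k hk`. [folklore] -/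
theorem siteEquivTowerAt_shiftEquiv {k : ℕ} (hk : n + k = K) (x : Site (F.P K) 0) (μ : Fin 3) :
    siteEquivTowerAt F n K k hk (x.shift μ) = B9Eq33CovDerivVector.shiftEquiv μ (siteEquivTowerAt F n K k hk x) :=
  siteEquivTowerAt_shift hk x μ

/-- … and the inverse chart. [folklore] -/
theorem siteEquivTowerAt_symm_shift {k : ℕ} (hk : n + k = K) (z : TSite 3 (towerP F.L (towerPeriodsT3 F n) k)) (μ : Fin 3) :
    (siteEquivTowerAt F n K k hk).symm (shift μ z) = ((siteEquivTowerAt F n K k hk).symm z).shift μ := by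
  apply (siteEquivTowerAt F n K k hk).injective
  rw [Equiv.apply_symm_apply, siteEquivTowerAt_shift, Equiv.apply_symm_apply]

variable (F n K) in
/-- **THE [B11] BACKGROUND AT HEIGHT `k`** (`n + k = K`): `SU(2) ≤ U(2) → (M₂(ℂ))ˣ` re-indexed along `siteEquivTowerAt`. [cite: Balaban1985Averaging, (19) p.21] -/
def bgOfCfgTowerAt (k : ℕ) (hk : n + k = K) (U : GaugeField (F.P K) 0 (Matrix.specialUnitaryGroup (Fin 2) ℂ)) :
    Bond 3 (towerP F.L (towerPeriodsT3 F n) k) → (Matrix (Fin 2) (Fin 2) ℂ)ˣ :=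
  cfgEquivOf (siteEquivTowerAt F n K k hk) _ (unitsField (toUField U))

/-- **THE BACKGROUND AS A LAMBDA**: `bgOfCfgTowerAt … U₀ = fun b ↦ unitsField (toUField U₀) ⟨e⁻¹ b.1, b.2⟩`. [cite: Balaban1985Averaging, (19) p.21] -/
theorem bgOfCfgTowerAt_eq {k : ℕ} (hk : n + k = K) (U : GaugeField (F.P K) 0 (Matrix.specialUnitaryGroup (Fin 2) ℂ)) :
    bgOfCfgTowerAt F n K k hk U = fun b => unitsField (toUField U) ⟨(siteEquivTowerAt F n K k hk).symm b.1, b.2⟩ := rfl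

/-- The background's bond matrix is the configuration's matrix at the pulled-back bond. [cite: Balaban1985Averaging, (19) p.21] -/
theorem val_bgOfCfgTowerAt {k : ℕ} (hk : n + k = K) (U : GaugeField (F.P K) 0 (Matrix.specialUnitaryGroup (Fin 2) ℂ))
    (p : Bond 3 (towerP F.L (towerPeriodsT3 F n) k)) :
    ((bgOfCfgTowerAt F n K k hk U p : (Matrix (Fin 2) (Fin 2) ℂ)ˣ) : Matrix (Fin 2) (Fin 2) ℂ) =
      ((U ((bondEquivOf (siteEquivTowerAt F n K k hk)).symm p) : Matrix.specialUnitaryGroup (Fin 2) ℂ) : Matrix (Fin 2) (Fin 2) ℂ) := rfl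

/-- **THE BACKGROUND IS `G`-VALUED** at height `k`. [cite: Balaban1985Variational, p.277] -/
theorem isUnitaryBg_bgOfCfgTowerAt {k : ℕ} (hk : n + k = K) (U : GaugeField (F.P K) 0 (Matrix.specialUnitaryGroup (Fin 2) ℂ)) :
    B11Prop6Concrete.IsUnitaryBg (bgOfCfgTowerAt F n K k hk U) :=
  isUnitaryBg_unitsField_toUField_comp U (bondEquivOf (siteEquivTowerAt F n K k hk)).symm

end Summit.QuantumFields.YangMills.Theorems.Prop7SectET3TransportTower

end
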